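import Summits.BirchSwinnertonDyer.Rank1Residual.LW16.DescentReRouteShape
import Literature.NumberTheory.EllipticCurves.SelmerCountShaTorsionProofs
import Literature.NumberTheory.EllipticCurves.BSDAverageRankFiveSelmer
import HarnessLib

/-!
# LW16 re-route kernel, FULL-DESCENT display: `BSD(E,p)` per pair from an exact (or upper-bound)
# `p`-descent count `#Sel^(p)(E/ℚ) ≤ p^{r_an} · #E(ℚ)[p]` (derived `hSha`), torsion-aware

HONEST FRAMING (cell `pub/bsd-litref/lw16`, seat `bsd-litref-lw16-eng` g6; programme BSD-LIT2PART v1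
§T3/§T4, RESISO RETURNS): nothing here proves BSD; per pair, never a class theorem; NOTHING is booked by
this file (the desk books). This is the DERIVED-DISPLAY companion (referee A2 pricing wake bc7791e3, ask
(γ)(b)) of `DescentReRouteShapeCT` for the OTHER second engine the lane ran on every RESISO-RETURNS @3 cell:
a Schaefer–Stoll FULL 3-DESCENT (cgs25's `desc3borel`, kits j280958 / j281991) whose output line is
`dim_{𝔽₃} Sel^(3)(E/ℚ) = r + dim_{𝔽₃} E(ℚ)[3]` with certified class groups. Instead of READING
`hSha : Ш(E/ℚ)[p] = 0`, the record READS the descent count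
`hSel : #Sel^(p)(E/ℚ) ≤ p^{r_an} · #E(ℚ)[p]` and DERIVES `hSha` in the tree: Gross–Zagier–Kolyvagin
(`hGZK`) gives `rank E(ℚ) = r_an`; the Kummer embedding gives the LOWER bound
`p^{rank} · #E(ℚ)[p] ≤ #Sel^(p)` (`WeierstrassCurve.pow_mordellWeilRank_mul_card_torsionBy_le_card_selmerGroup`,
PROVED); so the count is EXACT, and the exact descent count `#Sel^(p) = p^{rank} · #E(ℚ)[p] · #Ш[p]`
(Silverman X.4.2, `WeierstrassCurve.natCard_selmerGroup_eq`, PROVED) leaves `Ш(E/ℚ)[p] = 0`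
(`WeierstrassCurve.sha_torsion_eq_zero_of_natCard_selmerGroup_eq`, p543805). This is the TORSION-AWARE
sibling of `Typed.bsdp_of_card_selmerGroup_le_pow_analyticRank` (which needs `E(ℚ)[p] = 0`): 1 485 of the
2 347 @3 RETURNS cells have `3 ∣ #E(ℚ)_tors`. Theorems only (no definition, no named fact, no `sorry`).

References: [SilvermanAEC2009] Thm. X.4.2; [SchaeferStoll2004] §1; [MillerStoll2013] Thm. 9.1;
[Miller2011LMS] §1, Def. 1.1.
-/

set_option autoImplicit false

noncomputable section

open scoped Classical
open scoped AddSubgroup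

open WeierstrassCurve Literature.NumberTheory.EllipticCurves
  Literature.NumberTheory.EllipticCurves.Rank1Residual.Typed
  Literature.NumberTheory.EllipticCurves.Rank1Residual.X11RankOneCertificates
  Summit.BirchSwinnertonDyer.Rank1Residual.X11b

namespace Summit.BirchSwinnertonDyer.Rank1Residual.LW16

/-- **Record shape (full-descent display), analytic rank `≤ 1`.** On the literal model `[a₁,a₂,a₃,a₄,a₆]`
(`Δ ≠ 0` kernel-decided), `BSD(E,p)` from: GZK (`hGZK`), `r_an ≤ 1` (`hr`), `#Ш_an = q` with
`ord_p q = 0` (`hq`, `hv`), and the descent count `#Sel^(p)(E/ℚ) ≤ p^{r_an} · #E(ℚ)[p]` (`hSel`; an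
exact count is the case of equality). The composition is `bsdp_of_ainvs_of_noPTorsionSha` fed with
`sha_torsion_eq_zero_of_natCard_selmerGroup_eq`, the equality coming from the Kummer lower bound and
`rank = r_an`. [cite: SilvermanAEC2009, Thm X.4.2] [cite: Miller2011LMS, §1 and Def. 1.1] -/
theorem bsdp_of_ainvs_of_natCard_selmerGroup_le
    (hGZK : rank_eq_analyticRank_of_analyticRank_le_one)
    (a1 a2 a3 a4 a6 : ℤ) (p : ℕ) [Fact p.Prime] (hΔ : discOf [a1, a2, a3, a4, a6] ≠ 0)
    (hr : (⟨a1, a2, a3, a4, a6⟩ : WeierstrassCurve ℚ).analyticRank ≤ 1) {q : ℚ}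
    (hq : shaAn (⟨a1, a2, a3, a4, a6⟩ : WeierstrassCurve ℚ) = (q : ℂ)) (hv : padicValRat p q = 0)
    (hSel : Nat.card ((⟨a1, a2, a3, a4, a6⟩ : WeierstrassCurve ℚ).selmerGroup p) ≤
      p ^ (⟨a1, a2, a3, a4, a6⟩ : WeierstrassCurve ℚ).analyticRank *
        Nat.card ((⟨a1, a2, a3, a4, a6⟩ : WeierstrassCurve ℚ).toAffine.Point[(p : ℤ)])) :
    BSDp (⟨a1, a2, a3, a4, a6⟩ : WeierstrassCurve ℚ) p := by
  haveI := isElliptic_of_discOf_ne_zero a1 a2 a3 a4 a6 hΔ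
  have hp : p ≠ 0 := (Fact.out : p.Prime).ne_zero
  have hrk : (⟨a1, a2, a3, a4, a6⟩ : WeierstrassCurve ℚ).mordellWeilRank =
      (⟨a1, a2, a3, a4, a6⟩ : WeierstrassCurve ℚ).analyticRank := (hGZK _ hr).1
  -- the Kummer lower bound is stated in the tree under the classical `DecidableEq ℚ`; the binder here
  -- elaborates with `instDecidableEqRat` — `convert` bridges the (subsingleton) instance
  have hlow : p ^ (⟨a1, a2, a3, a4, a6⟩ : WeierstrassCurve ℚ).mordellWeilRank *
      Nat.card ((⟨a1, a2, a3, a4, a6⟩ : WeierstrassCurve ℚ).toAffine.Point[(p : ℤ)]) ≤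
        Nat.card ((⟨a1, a2, a3, a4, a6⟩ : WeierstrassCurve ℚ).selmerGroup p) := by
    convert (⟨a1, a2, a3, a4, a6⟩ : WeierstrassCurve ℚ).pow_mordellWeilRank_mul_card_torsionBy_le_card_selmerGroup hp
  have heq : Nat.card ((⟨a1, a2, a3, a4, a6⟩ : WeierstrassCurve ℚ).selmerGroup p) =
      p ^ (⟨a1, a2, a3, a4, a6⟩ : WeierstrassCurve ℚ).mordellWeilRank *
        Nat.card ((⟨a1, a2, a3, a4, a6⟩ : WeierstrassCurve ℚ).toAffine.Point[(p : ℤ)]) := by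
    refine le_antisymm ?_ hlow
    rw [hrk]; exact hSel
  exact bsdp_of_ainvs_of_noPTorsionSha hGZK a1 a2 a3 a4 a6 p hΔ hr hq hv
    ((⟨a1, a2, a3, a4, a6⟩ : WeierstrassCurve ℚ).sha_torsion_eq_zero_of_natCard_selmerGroup_eq' hp heq)

/-- **Full-descent display, analytic rank `0`**: the descent count reads `#Sel^(p)(E/ℚ) ≤ #E(ℚ)[p]`.
[cite: SilvermanAEC2009, Thm X.4.2] [cite: Miller2011LMS, §1 and Def. 1.1] -/
theorem bsdp_rankZero_of_ainvs_of_natCard_selmerGroup_le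
    (hGZK : rank_eq_analyticRank_of_analyticRank_le_one)
    (a1 a2 a3 a4 a6 : ℤ) (p : ℕ) [Fact p.Prime] (hΔ : discOf [a1, a2, a3, a4, a6] ≠ 0)
    (hr : (⟨a1, a2, a3, a4, a6⟩ : WeierstrassCurve ℚ).analyticRank = 0) {q : ℚ}
    (hq : shaAn (⟨a1, a2, a3, a4, a6⟩ : WeierstrassCurve ℚ) = (q : ℂ)) (hv : padicValRat p q = 0)
    (hSel : Nat.card ((⟨a1, a2, a3, a4, a6⟩ : WeierstrassCurve ℚ).selmerGroup p) ≤
      Nat.card ((⟨a1, a2, a3, a4, a6⟩ : WeierstrassCurve ℚ).toAffine.Point[(p : ℤ)])) :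
    BSDp (⟨a1, a2, a3, a4, a6⟩ : WeierstrassCurve ℚ) p :=
  bsdp_of_ainvs_of_natCard_selmerGroup_le hGZK a1 a2 a3 a4 a6 p hΔ (by omega) hq hv
    (by rw [hr, pow_zero, one_mul]; exact hSel)

/-- **Full-descent display, analytic rank `1`**: the descent count reads `#Sel^(p)(E/ℚ) ≤ p · #E(ℚ)[p]`.
[cite: SilvermanAEC2009, Thm X.4.2] [cite: Miller2011LMS, §1 and Def. 1.1] -/
theorem bsdp_rankOne_of_ainvs_of_natCard_selmerGroup_le
    (hGZK : rank_eq_analyticRank_of_analyticRank_le_one)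
    (a1 a2 a3 a4 a6 : ℤ) (p : ℕ) [Fact p.Prime] (hΔ : discOf [a1, a2, a3, a4, a6] ≠ 0)
    (hr : (⟨a1, a2, a3, a4, a6⟩ : WeierstrassCurve ℚ).analyticRank = 1) {q : ℚ}
    (hq : shaAn (⟨a1, a2, a3, a4, a6⟩ : WeierstrassCurve ℚ) = (q : ℂ)) (hv : padicValRat p q = 0)
    (hSel : Nat.card ((⟨a1, a2, a3, a4, a6⟩ : WeierstrassCurve ℚ).selmerGroup p) ≤
      p * Nat.card ((⟨a1, a2, a3, a4, a6⟩ : WeierstrassCurve ℚ).toAffine.Point[(p : ℤ)])) :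
    BSDp (⟨a1, a2, a3, a4, a6⟩ : WeierstrassCurve ℚ) p :=
  bsdp_of_ainvs_of_natCard_selmerGroup_le hGZK a1 a2 a3 a4 a6 p hΔ (by omega) hq hv
    (by rw [hr, pow_one]; exact hSel)

end Summit.BirchSwinnertonDyer.Rank1Residual.LW16
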